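import Summits.BirchSwinnertonDyer.BirchSwinnertonDyer.Theorems.CMKolyvaginAtInertTwoLagrangianTransversalLayered
import Summits.BirchSwinnertonDyer.BirchSwinnertonDyer.Theorems.CMKolyvaginAtInertTwoLayerCardSquareAtTwo
import Summits.BirchSwinnertonDyer.BirchSwinnertonDyer.Theorems.CMKolyvaginAtInertTwoLiftGroupsAtTwo
import HarnessLib

/-!
# Route `CMKolyvaginAtInertTwo`, crux `CMKolyvaginExactAtInertTwo` (stmt-BirchSwinnertonDyer-24277):
# THE LIFT GROUPS WITH (IND), DOUBLY-FILTERED CASE, REDUCED TO THE THREADING LEMMA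
# (T5′ of MEMO-T5 §4 / KERNEL-STATUS §13.3–13.5)

Seat `bsd-line-cmk2-p1` g14 (cell `bsd-print-cf2`); helper (`--supports stmt-BirchSwinnertonDyer-24277`).
THEOREMS ONLY: no definition, no named fact, no `sorry`; no item is closed; BSD is not proved by this.
Pure finite-abelian-group algebra; sequel of `…LiftGroupsAtTwo` (p683033: one side elementary),
`…LagrangianTransversalLayered` (p684886: the layered transversal Lagrangian) and
`…LayerCardSquareAtTwo` (the layers `p^jT ∩ T[p]` of a symplectic module have order `p^{2m}`).

THE ABSTRACT SITUATION (module docstring of `…LiftGroupsAtTwo`): `S₁ ↠π A` with kernel `⟨x⟩`, `x`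
of maximal order; nondegenerate alternating `ℚ/ℤ`-pairings on `A` and `S₂`, both `p`-groups
(`p^k` kills them); injective `r₁ : S₁ → G`, `r₂ : S₂ → G`. WANTED: `Zp ≤ S₁`, `Zm ≤ S₂` with
`Zp ∩ ⟨x⟩ = 0`, `π(Zp)`, `Zm` isotropic of orders `√#A`, `√#S₂`, and (IND) `r₁(Zp) ∩ r₂(Zm) = 0`.

THE TWO-SIDED REDUCTION. Split `S₁ = ⟨x⟩ ⊕ A'`. Let `C = {a ∈ A'[p] : r₁ a ∈ r₂ S₂}` (the collisions,
an elementary abelian `p`-group) with its two descending chains `P_j = C ∩ p^jA'` and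
`Q_i = {c ∈ C : r₁ c ∈ r₂(p^i S₂)}`, and the half-exponents `α_j`, `β_i` of the layers
(`#(p^jA' ∩ A'[p]) = p^{2α_j}`, `#(p^iS₂ ∩ S₂[p]) = p^{2β_i}`). Then `#(P_j ∩ Q_i) ≤ p^{α_j + β_i}`
(it embeds in both layers). IF a subgroup `Y ≤ C` THREADS the two chains — at most `α_j` dimensions
of `P_j` outside `Y` (`#P_j ≤ p^{α_j} · #(Y ∩ P_j)`) and at most `β_i` dimensions of `Q_i` inside `Y`
(`#(Y ∩ Q_i) ≤ p^{β_i}`) — then: the layered transversal Lagrangian on `S₂` gives `Zm` avoiding the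
image of `Y`; the collisions of `Zm` with `A'[p]` form a subgroup `W ≤ C` meeting `Y` trivially, hence
with `#(W ∩ P_j) ≤ p^{α_j}`; the layered transversal Lagrangian on `A'` gives `D'` avoiding `W`; and a
non-zero collision between `D'` and `Zm` would have a non-zero `p`-torsion multiple in `D' ∩ W`.

* `exists_liftGroups_of_threading` — (IND) in the doubly-filtered case GIVEN the threading lemma
  (hypothesis `hthread`, universally quantified: for every finite elementary abelian `p`-group `C`,
  descending chains `P, Q` and capacities `a, b` with `#(P_j ∩ Q_i) ≤ p^{a_j} p^{b_i}`, a threading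
  `Y` exists). The threading lemma itself — Hall's marriage theorem on a basis of `C` adapted to
  both chains (KERNEL-STATUS §13.5) — is the ONE remaining piece of T5′; it is pure combinatorics
  of two flags in an `𝔽_p`-space.

References: [McCallumLMS1991] §5 Thm. 5.4 (p. 307); [Hungerford1974] Ch. II §2 Ex. 2.
-/

-- single-conjunct summit: `Summit.BirchSwinnertonDyer.BirchSwinnertonDyer.…` repeats the name by design
set_option linter.dupNamespace false
set_option autoImplicit false

noncomputable section

open AddSubgroup Literature.GroupTheory.FiniteAbelian

namespace Summit.BirchSwinnertonDyer.BirchSwinnertonDyer.Theorems.KolyvaginLiftGroupsTwo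

universe u v w

section TwoSided

variable {G : Type w} [AddCommGroup G]
  {S₁ : Type u} [AddCommGroup S₁] [Finite S₁]
  {S₂ : Type u} [AddCommGroup S₂] [Finite S₂]
  {A : Type v} [AddCommGroup A]

/-- The pairing `B_A` pulled back along a map `f : X → A` is alternating if `B_A` is. [folklore] -/
private theorem alt_pullback' {X : Type*} [AddCommGroup X] (BA : A →+ A →+ AddCircle (1 : ℚ))
    (halt : ∀ a, BA a a = 0) (f : X →+ A) : ∀ z : X, (BA.comp f).compl₂ f z z = 0 :=
  fun z ↦ by rw [AddMonoidHom.compl₂_apply, AddMonoidHom.comp_apply]; exact halt (f z)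

/-- The pairing `B_A` pulled back along a BIJECTION `f : X → A` is nondegenerate if `B_A` is.
[folklore] -/
private theorem nondeg_pullback' {X : Type*} [AddCommGroup X] (BA : A →+ A →+ AddCircle (1 : ℚ))
    (hnd : ∀ a, (∀ b, BA a b = 0) → a = 0) (f : X →+ A) (hf : Function.Bijective f) :
    ∀ z : X, (∀ w : X, (BA.comp f).compl₂ f z w = 0) → z = 0 := by
  intro z hz
  have h0 : f z = 0 := hnd (f z) fun b ↦ by
    obtain ⟨w, rfl⟩ := hf.2 b
    have := hz w
    rwa [AddMonoidHom.compl₂_apply, AddMonoidHom.comp_apply] at this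
  exact hf.1 (by rw [h0, map_zero])

/-- Images under injective maps have the same order. [folklore] -/
private theorem card_map_of_injective' {X Y : Type*} [AddCommGroup X] [AddCommGroup Y]
    (f : X →+ Y) (hf : Function.Injective f) (H : AddSubgroup X) :
    Nat.card (H.map f) = Nat.card H :=
  (Nat.card_congr (AddSubgroup.equivMapOfInjective H f hf).toEquiv).symm

/-- An image of a finite subgroup is finite. [folklore] -/
private theorem finite_map' {X Y : Type*} [AddCommGroup X] [AddCommGroup Y] (f : X →+ Y)
    (H : AddSubgroup X) [Finite H] : Finite (H.map f) := by
  haveI : Finite (H.map f : Set Y) := (Set.toFinite (H : Set X)).image f |>.to_subtype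
  exact this

/-- **(IND) in the doubly-filtered case, modulo the threading lemma.** See the module docstring.
[cite: McCallumLMS1991, §5 Thm. 5.4 (proof, p. 307: the maximal isotropic subgroup D)] -/
theorem exists_liftGroups_of_threading {p : ℕ} (hp : p.Prime)
    (hthread : ∀ (C : Type u) [AddCommGroup C] [Finite C] (P Q : ℕ → AddSubgroup C) (a b : ℕ → ℕ),
      (∀ c : C, p • c = 0) → Antitone P → Antitone Q →
      (∀ j i, Nat.card ↥(P j ⊓ Q i) ≤ p ^ a j * p ^ b i) →
      ∃ Y : AddSubgroup C, (∀ j, Nat.card ↥(P j) ≤ p ^ a j * Nat.card ↥(Y ⊓ P j)) ∧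
        (∀ i, Nat.card ↥(Y ⊓ Q i) ≤ p ^ b i))
    (π : S₁ →+ A) (hπ : Function.Surjective π) (x : S₁)
    (hker : π.ker = zmultiples x) (hx : addOrderOf x = AddMonoid.exponent S₁)
    (BA : A →+ A →+ AddCircle (1 : ℚ)) (hAalt : ∀ a, BA a a = 0)
    (hAnd : ∀ a, (∀ b, BA a b = 0) → a = 0)
    (BB : S₂ →+ S₂ →+ AddCircle (1 : ℚ)) (hBalt : ∀ v, BB v v = 0)
    (hBnd : ∀ v, (∀ w, BB v w = 0) → v = 0) {k : ℕ} (hpA : ∀ a : A, p ^ k • a = 0)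
    (hpB : ∀ v : S₂, p ^ k • v = 0)
    (r₁ : S₁ →+ G) (r₂ : S₂ →+ G) (hr₁ : Function.Injective r₁) (hr₂ : Function.Injective r₂) :
    ∃ (Zp : AddSubgroup S₁) (Zm : AddSubgroup S₂),
      Disjoint (zmultiples x) Zp ∧
      (∀ a ∈ Zp, ∀ b ∈ Zp, BA (π a) (π b) = 0) ∧ Nat.card Zp ^ 2 = Nat.card A ∧
      (∀ v ∈ Zm, ∀ w ∈ Zm, BB v w = 0) ∧ Nat.card Zm ^ 2 = Nat.card S₂ ∧
      (∀ u ∈ Zp, ∀ v ∈ Zm, r₁ u = r₂ v → u = 0 ∧ v = 0) := by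
  classical
  haveI : Fact p.Prime := ⟨hp⟩
  -- `S₁ = ⟨x⟩ ⊕ A'`, `π : A' ≅ A`, the transported pairing `B'` on `A'`
  obtain ⟨A', hc, hbij⟩ := exists_isCompl_bijective_restrict π hπ x hker hx
  set ι : A' →+ S₁ := A'.subtype with hι_def
  set πA : A' →+ A := π.comp ι with hπA_def
  set B' : A' →+ A' →+ AddCircle (1 : ℚ) := (BA.comp πA).compl₂ πA with hB'_def
  have hB' : ∀ a b : A', B' a b = BA (π a) (π b) := fun a b ↦ rfl
  have halt' : ∀ a : A', B' a a = 0 := alt_pullback' BA hAalt πA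
  have hnd' : ∀ a : A', (∀ b : A', B' a b = 0) → a = 0 := nondeg_pullback' BA hAnd πA hbij
  have hpA' : ∀ a : A', p ^ k • a = 0 := fun a ↦ hbij.1 (by rw [map_nsmul, hpA, map_zero])
  have hcardA' : Nat.card A' = Nat.card A := Nat.card_congr (Equiv.ofBijective πA hbij)
  set rι : A' →+ G := r₁.comp ι with hrι_def
  have hrι : Function.Injective rι := hr₁.comp A'.subtype_injective
  -- layers
  set RA : ℕ → AddSubgroup A' := fun j ↦ (nsmulAddMonoidHom (p ^ j) : A' →+ A').range with hRA_def
  set TA : AddSubgroup A' := (nsmulAddMonoidHom p : A' →+ A').ker with hTA_def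
  set RB : ℕ → AddSubgroup S₂ := fun j ↦ (nsmulAddMonoidHom (p ^ j) : S₂ →+ S₂).range with hRB_def
  set TB : AddSubgroup S₂ := (nsmulAddMonoidHom p : S₂ →+ S₂).ker with hTB_def
  have hmemRA : ∀ j t, t ∈ RA j ↔ ∃ s : A', (p ^ j) • s = t := fun j t ↦ by
    rw [hRA_def]; simp only [AddMonoidHom.mem_range, nsmulAddMonoidHom_apply]
  have hmemRB : ∀ j t, t ∈ RB j ↔ ∃ s : S₂, (p ^ j) • s = t := fun j t ↦ by
    rw [hRB_def]; simp only [AddMonoidHom.mem_range, nsmulAddMonoidHom_apply]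
  have hmemTA : ∀ t, t ∈ TA ↔ p • t = 0 := fun t ↦ by
    rw [hTA_def, AddMonoidHom.mem_ker, nsmulAddMonoidHom_apply]
  have hmemTB : ∀ t, t ∈ TB ↔ p • t = 0 := fun t ↦ by
    rw [hTB_def, AddMonoidHom.mem_ker, nsmulAddMonoidHom_apply]
  have hα' : ∀ j, ∃ m, Nat.card ↥(RA j ⊓ TA) = p ^ (2 * m) := fun j ↦
    exists_natCard_layer_eq_pow_two_mul B' halt' hnd' hp (p ^ j)
  choose α hα using hα'
  have hβ' : ∀ j, ∃ m, Nat.card ↥(RB j ⊓ TB) = p ^ (2 * m) := fun j ↦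
    exists_natCard_layer_eq_pow_two_mul BB hBalt hBnd hp (p ^ j)
  choose β hβ using hβ'
  -- the collision subgroup `C ≤ A'[p]` and its two chains
  set Csub : AddSubgroup A' := TA ⊓ r₂.range.comap rι with hC_def
  have hmemC : ∀ c, c ∈ Csub ↔ p • c = 0 ∧ ∃ v : S₂, r₂ v = rι c := fun c ↦ by
    rw [hC_def, AddSubgroup.mem_inf, hmemTA, AddSubgroup.mem_comap, AddMonoidHom.mem_range]
  have hCp : ∀ c : Csub, p • c = 0 := fun c ↦ Subtype.ext (by
    rw [AddSubgroup.coe_nsmul, ((hmemC _).mp c.2).1, AddSubgroup.coe_zero])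
  set P : ℕ → AddSubgroup Csub := fun j ↦ (RA j).comap Csub.subtype with hP_def
  set Q : ℕ → AddSubgroup Csub := fun i ↦ (((RB i).map r₂).comap rι).comap Csub.subtype with hQ_def
  have hmemP : ∀ j (c : Csub), c ∈ P j ↔ (c : A') ∈ RA j := fun j c ↦ by
    rw [hP_def, AddSubgroup.mem_comap]; rfl
  have hmemQ : ∀ i (c : Csub), c ∈ Q i ↔ ∃ v ∈ RB i, r₂ v = rι c := fun i c ↦ by
    rw [hQ_def, AddSubgroup.mem_comap, AddSubgroup.mem_comap, AddSubgroup.mem_map]; rfl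
  have hPanti : Antitone P := fun j j' h ↦ AddSubgroup.comap_mono (range_nsmul_pow_le h)
  have hQanti : Antitone Q := fun i i' h ↦
    AddSubgroup.comap_mono (AddSubgroup.comap_mono (AddSubgroup.map_mono (range_nsmul_pow_le h)))
  -- the Hall condition `#(P_j ∩ Q_i) ≤ p^{α_j + β_i}`
  have hHall : ∀ j i, Nat.card ↥(P j ⊓ Q i) ≤ p ^ α j * p ^ β i := by
    intro j i
    set X : AddSubgroup Csub := P j ⊓ Q i with hX_def
    have h1 : Nat.card X ≤ p ^ (2 * α j) := by
      rw [← hα j, ← card_map_of_injective' Csub.subtype Csub.subtype_injective X]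
      refine AddSubgroup.card_le_of_le ?_
      rintro t ⟨c, hc, rfl⟩
      exact AddSubgroup.mem_inf.mpr ⟨(hmemP j c).mp (AddSubgroup.mem_inf.mp hc).1,
        (AddSubgroup.mem_inf.mp c.2).1⟩
    have h2 : Nat.card X ≤ p ^ (2 * β i) := by
      haveI : Finite ((RB i ⊓ TB).map r₂) := finite_map' r₂ _
      rw [← hβ i, ← card_map_of_injective' r₂ hr₂ (RB i ⊓ TB),
        ← card_map_of_injective' (rι.comp Csub.subtype) (hrι.comp Csub.subtype_injective) X]
      refine AddSubgroup.card_le_of_le ?_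
      rintro t ⟨c, hc, rfl⟩
      obtain ⟨v, hvR, hv⟩ := (hmemQ i c).mp (AddSubgroup.mem_inf.mp hc).2
      refine AddSubgroup.mem_map.mpr ⟨v, AddSubgroup.mem_inf.mpr ⟨hvR, (hmemTB v).mpr (hr₂ ?_)⟩, ?_⟩
      · rw [map_nsmul, hv, map_zero, ← map_nsmul, ← AddSubgroup.coe_nsmul, hCp c,
          AddSubgroup.coe_zero, map_zero]
      · rw [hv]; rfl
    have h3 : Nat.card X ^ 2 ≤ (p ^ α j * p ^ β i) ^ 2 := by
      calc Nat.card X ^ 2 = Nat.card X * Nat.card X := sq _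
        _ ≤ p ^ (2 * α j) * p ^ (2 * β i) := Nat.mul_le_mul h1 h2
        _ = (p ^ α j * p ^ β i) ^ 2 := by ring
    exact (Nat.pow_le_pow_iff_left two_ne_zero).mp h3
  -- THE THREADING `Y`
  obtain ⟨Y, hYα, hYβ⟩ := hthread Csub P Q α β hCp hPanti hQanti hHall
  -- B-side: `Zm` avoids the image of `Y`
  set YB : AddSubgroup S₂ := ((Y.map Csub.subtype).map rι).comap r₂ with hYB_def
  have hmemYB : ∀ v, v ∈ YB ↔ ∃ y : Csub, y ∈ Y ∧ rι y = r₂ v := fun v ↦ by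
    rw [hYB_def, AddSubgroup.mem_comap, AddSubgroup.mem_map]
    constructor
    · rintro ⟨t, ht, htv⟩
      obtain ⟨y, hy, rfl⟩ := AddSubgroup.mem_map.mp ht
      exact ⟨y, hy, htv⟩
    · rintro ⟨y, hy, hyv⟩
      exact ⟨(y : A'), AddSubgroup.mem_map.mpr ⟨y, hy, rfl⟩, hyv⟩
  have hYBp : ∀ v ∈ YB, p • v = 0 := by
    intro v hv
    obtain ⟨y, -, hyv⟩ := (hmemYB v).mp hv
    apply hr₂
    rw [map_nsmul, ← hyv, map_zero, ← map_nsmul, ← AddSubgroup.coe_nsmul, hCp y, AddSubgroup.coe_zero,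
      map_zero]
  have hYBlayer : ∀ i, Nat.card ↥(YB ⊓ RB i) ^ 2 ≤ Nat.card ↥(RB i ⊓ TB) := by
    intro i
    haveI : Finite (((Y ⊓ Q i).map Csub.subtype).map rι) := finite_map' _ _
    have h1 : Nat.card ↥(YB ⊓ RB i) ≤ Nat.card ↥(Y ⊓ Q i) := by
      rw [← card_map_of_injective' r₂ hr₂ (YB ⊓ RB i),
        ← card_map_of_injective' (rι.comp Csub.subtype) (hrι.comp Csub.subtype_injective) (Y ⊓ Q i),
        ← AddSubgroup.map_map]
      refine AddSubgroup.card_le_of_le ?_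
      rintro t ⟨v, hv, rfl⟩
      obtain ⟨hvY, hvR⟩ := AddSubgroup.mem_inf.mp hv
      obtain ⟨y, hy, hyv⟩ := (hmemYB v).mp hvY
      refine AddSubgroup.mem_map.mpr ⟨(y : A'), AddSubgroup.mem_map.mpr ⟨y, AddSubgroup.mem_inf.mpr
        ⟨hy, (hmemQ i y).mpr ⟨v, hvR, hyv.symm⟩⟩, rfl⟩, ?_⟩
      rw [← hyv]
    rw [hβ i, show p ^ (2 * β i) = (p ^ β i) ^ 2 by ring]
    exact Nat.pow_le_pow_left (h1.trans (hYβ i)) 2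
  obtain ⟨Zm, hZm_iso, hZm_card, hZm_inf⟩ :=
    exists_lagrangian_inf_eq_bot_of_layered BB hBalt hBnd hp hpB YB hYBp hYBlayer
  -- A-side: `D'` avoids the collisions `W` of `Zm` with `A'[p]`
  set W : AddSubgroup A' := TA ⊓ (Zm.map r₂).comap rι with hW_def
  have hmemW : ∀ a, a ∈ W ↔ p • a = 0 ∧ ∃ v ∈ Zm, r₂ v = rι a := fun a ↦ by
    rw [hW_def, AddSubgroup.mem_inf, hmemTA, AddSubgroup.mem_comap, AddSubgroup.mem_map]
  have hWp : ∀ a ∈ W, p • a = 0 := fun a ha ↦ ((hmemW a).mp ha).1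
  have hWC : W ≤ Csub := fun a ha ↦ by
    obtain ⟨hpa, v, -, hv⟩ := (hmemW a).mp ha
    exact (hmemC a).mpr ⟨hpa, v, hv⟩
  set W' : AddSubgroup Csub := W.comap Csub.subtype with hW'_def
  have hW'Y : Disjoint W' Y := by
    rw [AddSubgroup.disjoint_def]
    intro c hcW hcY
    obtain ⟨-, v, hvZ, hv⟩ := (hmemW _).mp (AddSubgroup.mem_comap.mp hcW)
    have hvYB : v ∈ YB := (hmemYB v).mpr ⟨c, hcY, hv.symm⟩
    have hv0 : v = 0 := by
      have : v ∈ Zm ⊓ YB := AddSubgroup.mem_inf.mpr ⟨hvZ, hvYB⟩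
      rwa [hZm_inf, AddSubgroup.mem_bot] at this
    rw [hv0, map_zero] at hv
    have : (c : A') = 0 := hrι (by rw [map_zero]; exact hv.symm)
    exact Subtype.ext this
  have hWlayer : ∀ j, Nat.card ↥(W ⊓ RA j) ^ 2 ≤ Nat.card ↥(RA j ⊓ TA) := by
    intro j
    have h1 : Nat.card ↥(W ⊓ RA j) = Nat.card ↥(W' ⊓ P j) := by
      have h2 : (W' ⊓ P j).map Csub.subtype = W ⊓ RA j := by
        ext a
        simp only [AddSubgroup.mem_map, AddSubgroup.mem_inf, hW'_def, AddSubgroup.mem_comap, hmemP,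
          AddSubgroup.coe_subtype]
        constructor
        · rintro ⟨c, ⟨hcW, hcR⟩, rfl⟩
          exact ⟨hcW, hcR⟩
        · rintro ⟨haW, haR⟩
          exact ⟨⟨a, hWC haW⟩, ⟨haW, haR⟩, rfl⟩
      rw [← h2, card_map_of_injective' Csub.subtype Csub.subtype_injective]
    have h3 := card_inf_mul_card_inf_le_of_disjoint hW'Y (P j)
    have h4 : Nat.card ↥(W' ⊓ P j) * Nat.card ↥(Y ⊓ P j) ≤ p ^ α j * Nat.card ↥(Y ⊓ P j) :=
      h3.trans (hYα j)
    have h5 : Nat.card ↥(W' ⊓ P j) ≤ p ^ α j := Nat.le_of_mul_le_mul_right h4 Nat.card_pos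
    rw [h1, hα j, show p ^ (2 * α j) = (p ^ α j) ^ 2 by ring]
    exact Nat.pow_le_pow_left h5 2
  obtain ⟨D', hD'_iso, hD'_card, hD'_inf⟩ :=
    exists_lagrangian_inf_eq_bot_of_layered B' halt' hnd' hp hpA' W hWp hWlayer
  -- the lift groups
  refine ⟨D'.map ι, Zm, hc.disjoint.mono_right (by rw [hι_def]; exact AddSubgroup.map_subtype_le D'),
    ?_, ?_, hZm_iso, hZm_card, ?_⟩
  · intro a ha b hb
    obtain ⟨a₀, ha₀, rfl⟩ := AddSubgroup.mem_map.mp ha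
    obtain ⟨b₀, hb₀, rfl⟩ := AddSubgroup.mem_map.mp hb
    have := hD'_iso a₀ ha₀ b₀ hb₀
    rwa [hB'] at this
  · rw [hι_def, card_map_of_injective' _ A'.subtype_injective, hD'_card, hcardA']
  · -- (IND): a non-zero collision has a non-zero `p`-torsion multiple in `D' ∩ W`
    intro u hu v hv huv
    obtain ⟨a₀, ha₀, rfl⟩ := AddSubgroup.mem_map.mp hu
    have ha₀0 : a₀ = 0 := by
      by_contra h0
      obtain ⟨s, -, hs⟩ : ∃ s ≤ k, addOrderOf a₀ = p ^ s :=
        (Nat.dvd_prime_pow hp).mp (addOrderOf_dvd_of_nsmul_eq_zero (hpA' a₀))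
      have hs0 : s ≠ 0 := by
        intro hs0
        rw [hs0, pow_zero, AddMonoid.addOrderOf_eq_one_iff] at hs
        exact h0 hs
      obtain ⟨t, rfl⟩ := Nat.exists_eq_succ_of_ne_zero hs0
      set a₁ : A' := (p ^ t) • a₀ with ha₁_def
      have ha₁0 : a₁ ≠ 0 := by
        intro h
        have : addOrderOf a₀ ∣ p ^ t := addOrderOf_dvd_of_nsmul_eq_zero h
        rw [hs, Nat.pow_dvd_pow_iff_le_right hp.one_lt] at this
        omega
      have hpa₁ : p • a₁ = 0 := by rw [ha₁_def, smul_smul, ← pow_succ', ← hs, addOrderOf_nsmul_eq_zero]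
      have ha₁W : a₁ ∈ W := by
        refine (hmemW a₁).mpr ⟨hpa₁, (p ^ t) • v, AddSubgroup.nsmul_mem _ hv _, ?_⟩
        rw [map_nsmul, ← huv, ha₁_def, map_nsmul]; rfl
      have : a₁ ∈ D' ⊓ W := AddSubgroup.mem_inf.mpr ⟨AddSubgroup.nsmul_mem _ ha₀ _, ha₁W⟩
      rw [hD'_inf, AddSubgroup.mem_bot] at this
      exact ha₁0 this
    subst ha₀0
    refine ⟨by rw [map_zero], hr₂ ?_⟩
    rw [← huv, map_zero, map_zero, map_zero]

end TwoSided

end Summit.BirchSwinnertonDyer.BirchSwinnertonDyer.Theorems.KolyvaginLiftGroupsTwo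

end
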